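import Summits.QuantumAdvantage.QuantumAdvantage.Theses.DarkClassGroups
import Literature.Computability.Cryptography.HallgrenClassGroup
import Literature.Computability.Cryptography.HallgrenClassGroupAssembly
import Literature.Computability.Cryptography.HallgrenClassGroupIdealEnumerationMachine
import Literature.Computability.Cryptography.HallgrenClassGroupTorsionWitnessTrial
import Literature.Computability.Cryptography.ShorProofs
import HarnessLib.Audit

/-!
# Line `bright-sampler-kernel` — piece P2 `BrightClassNumberQSolvable` of the BC2 redirect of
# `DarkClassGroups.ClassNumberFBQP` (stmt-QuantumAdvantage-11623) — skeleton v1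

Planner `planner-cstrat-stmt-QuantumAdvantage-11623-r1-0` (crux-strategist, RESTATED re-audit, 2026-08-17).

THE PIECE (verbatim the child statement; local stand-in until the split is materialised, then retarget
`BrightClassNumberQSolvable_of` to `…Theses.DarkClassGroups.BrightClassNumberQSolvable`): for every `C : ℕ` ONE
poly-time uniform oracle-free Clifford+T family outputs, with probability `≥ 2/3`, a string whose first `|x|` bits are
the low bits of `h(−d)`, `d = decodeNat x` (`h(−d) ≤ d < 2^|x|`: no bit lost, and — unlike a bare `encodeNat` prefix —
READABLE downstream), on every input that is a BRIGHT-at-`C` negative fundamental discriminant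
(`√d ≤ C·h(−d)·log d`); no requirement off the promise.  GRH-free and (i)-free: Hallgren 2005 / Childs–van Dam 2010
§5.7 with the Riemann hypothesis replaced by the ONE inequality its analysis consumes.

THE LINE = the tree's own `Hallgren2005_classNumber_qsolvable_of_GRH` architecture (files `HallgrenClassGroup*.lean`),
cut into its three remaining genuine pieces:
* S1 `stub_pairsGenerate` [L, LOAD-BEARING, number theory + probability, NO machines] — on a bright fundamental
  `d ≥ d₀(C)`, `T = n^A` uniform norm–index pairs `(a_t, k_t) ∈ [1, 2^{3n}] × [0, 2^{kBits n})` (`n = |bin d|`) select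
  forms `enumForm (−d) (factorPairs a_t) k_t` (the reduced form of the `k_t`-th ideal of norm `a_t`, when
  `k_t < enumCount` = `r_K(a_t)`) that GENERATE the form class group — `clGenOrder d L = h(−d)` — for at least `3/4`
  of all `T`-tuples.  Ingredients, all PROVED in the tree: per-class ideal count `le_card_ideals_of_class`
  (`≥ 2Y/√d − 2√Y − 1` ideals of norm `≤ Y` in EVERY class, Davenport Ch. 6), crowded norms are few
  (`HallgrenClassGroupCrowdedNorms`), brightness ⇒ `h ≥ √d/(C log d)` so a draw escapes any proper subgroup `H`
  (≤ `h/2` classes) with probability `≫ 1/(C·2^{kBits n}·log d)`, and the union bound over the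
  `≤ (h+1)^{log₂ h}` subgroups (`toOuterMeasure_closure_ne_top_le`, `card_subgroup_le`; `A = 9` suffices on paper).
  The mod-3 shadow of this count is LANDED (`le_sum_card_filter_mem_twbLang`, torsion witnesses).
* S2 `stub_subgroupOrderDelim` [M] — the SELF-DELIMITED subgroup order: on an instance code `encodeClInstance d L`
  the family outputs `⟨bin |⟨L⟩|, junk⟩ = boolPair (bin (clGenOrder d L)) junk` (prefix `boolPair · []`, and
  `boolPair a b ++ t = boolPair a (b ++ t)`).  Re-run of the PROVED `Hallgren2005.subgroupOrder_qsolvable_holds`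
  (`kernelProb_clOrderEst_ge` + `ClPostFP.clPost_mem_FP` + `isQSolvable_classicalWrap_holds`) with the post-processor
  `w ↦ boolPair (clPost w) []`; needed because a BARE `encodeNat` prefix cannot be read back by a classical caller
  (cf. `Cruxes/IqThreeMemBQP/Disproof.lean` §6).
* S3 `stub_samplerMachine` [L, generic plumbing, the classical oracle machine] — for ANY promise `P` and parameters
  `(A, d₀)`: the counting guarantee of S1's shape + S2 ⇒ the `|x|`-bit class number is `IsQSolvable` on
  `{fundamental} ∩ P`.  Proof plan: order-bit language `ORD = {⟨w, bin i⟩ : bit i of |⟨L⟩|}` ∈ `BQP` from S2 by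
  decision-from-search (as the landed `stub_threeOrdBit`), join `FB ⊕ ORD ∈ BQP` (`BQPJoinClosure`; `FB` = Shor factor
  bits), one `FP^{FB ⊕ ORD}` machine with coins: parse `T` coin blocks as `(a_t, k_t)` (`TorsionWitness.qry/block`),
  factor `a_t` through `FB` (`FactorWindow.exists_transducer`), roots by Cipolla from spare coins (`RootSlots`, failure
  `≤ 1/8` absorbed by running two independent batches and keeping the LARGER order — `|⟨L⟩| ≤ h` always, so `max` is
  monotone-correct), `enumFormR` (= `enumForm` on the good event, `enumFormR_withRoots`), query the `2|x|+2` order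
  bits, write `|x|` bits; table for `d < d₀`; then `isQSolvable_of_mem_FPRel_BQP_holds` (classical-base principle,
  PROVED) on the extension-closed prefix relation.
COMPOSITION `BrightClassNumberQSolvable_of` (kernel-checked): at `C`, take `(A, d₀)` from S1 and apply S3 with
`P d :≡ √d ≤ C·h(−d)·log d` (definitional unfolding only).

HONEST LABEL. S1 is strictly weaker than the piece (pure arithmetic statistics, no algorithm), S2 is a different
search problem (subgroup order on instance codes), S3 is generic in the promise `P` (it does not know brightness):
none restates the piece, the crux `ClassNumberFBQP`, the summit, or a refuted statement (negatives index: 6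
unrelated entries).  No Disproof.lean exists for stmt-11623.
-/

noncomputable section

set_option linter.dupNamespace false

namespace Summit.QuantumAdvantage.QuantumAdvantage.Cruxes.BrightClassNumberQSolvable.Birth

/-- THE PIECE (byte-identical stand-in for the route decl `DarkClassGroups.BrightClassNumberQSolvable`). -/
def BrightClassNumberQSolvable : Prop :=
  ∀ C : ℕ, Literature.Computability.Cryptography.IsQSolvable fun x : List Bool => {y : List Bool | (((-(Computability.decodeNat x : ℤ)) % 4 = 1 ∧ Squarefree (-(Computability.decodeNat x : ℤ)) ∧ (-(Computability.decodeNat x : ℤ)) ≠ 1) ∨ (4 ∣ (-(Computability.decodeNat x : ℤ)) ∧ ((-(Computability.decodeNat x : ℤ)) / 4 % 4 = 2 ∨ (-(Computability.decodeNat x : ℤ)) / 4 % 4 = 3) ∧ Squarefree ((-(Computability.decodeNat x : ℤ)) / 4))) → Real.sqrt (Computability.decodeNat x : ℝ) ≤ (C : ℝ) * (Literature.NumberTheory.QuadraticFields.BinaryQuadraticForm.classNumber (-(Computability.decodeNat x : ℤ)) : ℝ) * Real.log (Computability.decodeNat x : ℝ) → List.ofFn (fun i : Fin x.length => (Literature.NumberTheory.QuadraticFields.BinaryQuadraticForm.classNumber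 (-(Computability.decodeNat x : ℤ))).testBit i.val) <+: y}

/-! ## Registered stubs — `sorry` lives ONLY in these three theorems (statements fully qualified) -/

/-- Stub S1 `stub_pairsGenerate` [L, load-bearing]: uniform norm–index pairs generate the class group of a
bright fundamental discriminant with probability `≥ 3/4` (counting form). -/
theorem stub_pairsGenerate : ∀ C : ℕ, ∃ A d₀ : ℕ, ∀ d : ℕ, d₀ ≤ d → Literature.Computability.Cryptography.IsNegFundamentalDiscr d →
    Real.sqrt (d : ℝ) ≤ (C : ℝ) * (Literature.NumberTheory.QuadraticFields.BinaryQuadraticForm.classNumber (-(d : ℤ)) : ℝ) * Real.log (d : ℝ) →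
      3 * (((2 ^ (3 * (Computability.encodeNat d).length) * 2 ^ (Literature.Computability.Cryptography.Hallgren2005.TorsionWitness.kBits (Computability.encodeNat d).length)) ^ ((Computability.encodeNat d).length ^ A) : ℕ) : ℝ) ≤
        4 * ((Finset.univ.filter fun w : Fin ((Computability.encodeNat d).length ^ A) → Fin (2 ^ (3 * (Computability.encodeNat d).length)) × Fin (2 ^ (Literature.Computability.Cryptography.Hallgren2005.TorsionWitness.kBits (Computability.encodeNat d).length)) =>
          Literature.Computability.Cryptography.Hallgren2005.clGenOrder d ((List.ofFn w).filterMap fun jk =>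
            if jk.2.val < Literature.Computability.Cryptography.Hallgren2005.FormComposition.enumCount (-(d : ℤ)) (Literature.Computability.Cryptography.Hallgren2005.FormComposition.factorPairs (jk.1.val + 1))
            then some (Literature.Computability.Cryptography.Hallgren2005.FormComposition.toTriple (Literature.Computability.Cryptography.Hallgren2005.FormComposition.enumForm (-(d : ℤ)) (Literature.Computability.Cryptography.Hallgren2005.FormComposition.factorPairs (jk.1.val + 1)) jk.2.val))
            else none) = Literature.NumberTheory.QuadraticFields.BinaryQuadraticForm.classNumber (-(d : ℤ))).card : ℝ) := by
  sorry

/-- Stub S2 `stub_subgroupOrderDelim` [M]: the self-delimited order of a subgroup of the form class group given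
by generators is quantum-polynomial (instance format of `HallgrenClassGroupQuantumKernel`). -/
theorem stub_subgroupOrderDelim : Literature.Computability.Cryptography.IsQSolvable fun w : List Bool =>
    {y : List Bool | ∀ (d : ℕ) (L : List (ℕ × ℤ × ℕ)), w = Literature.Computability.Cryptography.Hallgren2005.encodeClInstance d L →
      Literature.Computability.Cryptography.Hallgren2005.IsClInstance d L →
        Literature.Computability.Complexity.boolPair (Computability.encodeNat (Literature.Computability.Cryptography.Hallgren2005.clGenOrder d L)) [] <+: y} := by
  sorry

/-- Stub S3 `stub_samplerMachine` [L, generic]: pair-sampling that generates (S1-shape hypothesis, any promise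
`P`) plus the delimited subgroup order (S2-shape hypothesis) put the `|x|`-bit class number in quantum polynomial
time on `{fundamental} ∩ P`. -/
theorem stub_samplerMachine : ∀ (P : ℕ → Prop) (A d₀ : ℕ),
    (∀ d : ℕ, d₀ ≤ d → Literature.Computability.Cryptography.IsNegFundamentalDiscr d → P d →
      3 * (((2 ^ (3 * (Computability.encodeNat d).length) * 2 ^ (Literature.Computability.Cryptography.Hallgren2005.TorsionWitness.kBits (Computability.encodeNat d).length)) ^ ((Computability.encodeNat d).length ^ A) : ℕ) : ℝ) ≤
        4 * ((Finset.univ.filter fun w : Fin ((Computability.encodeNat d).length ^ A) → Fin (2 ^ (3 * (Computability.encodeNat d).length)) × Fin (2 ^ (Literature.Computability.Cryptography.Hallgren2005.TorsionWitness.kBits (Computability.encodeNat d).length)) =>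
          Literature.Computability.Cryptography.Hallgren2005.clGenOrder d ((List.ofFn w).filterMap fun jk =>
            if jk.2.val < Literature.Computability.Cryptography.Hallgren2005.FormComposition.enumCount (-(d : ℤ)) (Literature.Computability.Cryptography.Hallgren2005.FormComposition.factorPairs (jk.1.val + 1))
            then some (Literature.Computability.Cryptography.Hallgren2005.FormComposition.toTriple (Literature.Computability.Cryptography.Hallgren2005.FormComposition.enumForm (-(d : ℤ)) (Literature.Computability.Cryptography.Hallgren2005.FormComposition.factorPairs (jk.1.val + 1)) jk.2.val))
            else none) = Literature.NumberTheory.QuadraticFields.BinaryQuadraticForm.classNumber (-(d : ℤ))).card : ℝ)) →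
    (Literature.Computability.Cryptography.IsQSolvable fun w : List Bool =>
    {y : List Bool | ∀ (d : ℕ) (L : List (ℕ × ℤ × ℕ)), w = Literature.Computability.Cryptography.Hallgren2005.encodeClInstance d L →
      Literature.Computability.Cryptography.Hallgren2005.IsClInstance d L →
        Literature.Computability.Complexity.boolPair (Computability.encodeNat (Literature.Computability.Cryptography.Hallgren2005.clGenOrder d L)) [] <+: y}) →
    Literature.Computability.Cryptography.IsQSolvable fun x : List Bool =>
      {y : List Bool | Literature.Computability.Cryptography.IsNegFundamentalDiscr (Computability.decodeNat x) → P (Computability.decodeNat x) →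
        List.ofFn (fun i : Fin x.length => (Literature.NumberTheory.QuadraticFields.BinaryQuadraticForm.classNumber (-(Computability.decodeNat x : ℤ))).testBit i.val) <+: y} := by
  sorry

/-! ### Name-keyed aliases of the stub STATEMENTS -/
namespace Registered

/-- Statement of S1. -/
abbrev stub_pairsGenerate : Prop := ∀ C : ℕ, ∃ A d₀ : ℕ, ∀ d : ℕ, d₀ ≤ d → Literature.Computability.Cryptography.IsNegFundamentalDiscr d →
    Real.sqrt (d : ℝ) ≤ (C : ℝ) * (Literature.NumberTheory.QuadraticFields.BinaryQuadraticForm.classNumber (-(d : ℤ)) : ℝ) * Real.log (d : ℝ) →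
      3 * (((2 ^ (3 * (Computability.encodeNat d).length) * 2 ^ (Literature.Computability.Cryptography.Hallgren2005.TorsionWitness.kBits (Computability.encodeNat d).length)) ^ ((Computability.encodeNat d).length ^ A) : ℕ) : ℝ) ≤
        4 * ((Finset.univ.filter fun w : Fin ((Computability.encodeNat d).length ^ A) → Fin (2 ^ (3 * (Computability.encodeNat d).length)) × Fin (2 ^ (Literature.Computability.Cryptography.Hallgren2005.TorsionWitness.kBits (Computability.encodeNat d).length)) =>
          Literature.Computability.Cryptography.Hallgren2005.clGenOrder d ((List.ofFn w).filterMap fun jk =>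
            if jk.2.val < Literature.Computability.Cryptography.Hallgren2005.FormComposition.enumCount (-(d : ℤ)) (Literature.Computability.Cryptography.Hallgren2005.FormComposition.factorPairs (jk.1.val + 1))
            then some (Literature.Computability.Cryptography.Hallgren2005.FormComposition.toTriple (Literature.Computability.Cryptography.Hallgren2005.FormComposition.enumForm (-(d : ℤ)) (Literature.Computability.Cryptography.Hallgren2005.FormComposition.factorPairs (jk.1.val + 1)) jk.2.val))
            else none) = Literature.NumberTheory.QuadraticFields.BinaryQuadraticForm.classNumber (-(d : ℤ))).card : ℝ)
/-- Statement of S2. -/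
abbrev stub_subgroupOrderDelim : Prop := Literature.Computability.Cryptography.IsQSolvable fun w : List Bool =>
    {y : List Bool | ∀ (d : ℕ) (L : List (ℕ × ℤ × ℕ)), w = Literature.Computability.Cryptography.Hallgren2005.encodeClInstance d L →
      Literature.Computability.Cryptography.Hallgren2005.IsClInstance d L →
        Literature.Computability.Complexity.boolPair (Computability.encodeNat (Literature.Computability.Cryptography.Hallgren2005.clGenOrder d L)) [] <+: y}
/-- Statement of S3. -/
abbrev stub_samplerMachine : Prop := ∀ (P : ℕ → Prop) (A d₀ : ℕ),
    (∀ d : ℕ, d₀ ≤ d → Literature.Computability.Cryptography.IsNegFundamentalDiscr d → P d →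
      3 * (((2 ^ (3 * (Computability.encodeNat d).length) * 2 ^ (Literature.Computability.Cryptography.Hallgren2005.TorsionWitness.kBits (Computability.encodeNat d).length)) ^ ((Computability.encodeNat d).length ^ A) : ℕ) : ℝ) ≤
        4 * ((Finset.univ.filter fun w : Fin ((Computability.encodeNat d).length ^ A) → Fin (2 ^ (3 * (Computability.encodeNat d).length)) × Fin (2 ^ (Literature.Computability.Cryptography.Hallgren2005.TorsionWitness.kBits (Computability.encodeNat d).length)) =>
          Literature.Computability.Cryptography.Hallgren2005.clGenOrder d ((List.ofFn w).filterMap fun jk =>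
            if jk.2.val < Literature.Computability.Cryptography.Hallgren2005.FormComposition.enumCount (-(d : ℤ)) (Literature.Computability.Cryptography.Hallgren2005.FormComposition.factorPairs (jk.1.val + 1))
            then some (Literature.Computability.Cryptography.Hallgren2005.FormComposition.toTriple (Literature.Computability.Cryptography.Hallgren2005.FormComposition.enumForm (-(d : ℤ)) (Literature.Computability.Cryptography.Hallgren2005.FormComposition.factorPairs (jk.1.val + 1)) jk.2.val))
            else none) = Literature.NumberTheory.QuadraticFields.BinaryQuadraticForm.classNumber (-(d : ℤ))).card : ℝ)) →
    (Literature.Computability.Cryptography.IsQSolvable fun w : List Bool =>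
    {y : List Bool | ∀ (d : ℕ) (L : List (ℕ × ℤ × ℕ)), w = Literature.Computability.Cryptography.Hallgren2005.encodeClInstance d L →
      Literature.Computability.Cryptography.Hallgren2005.IsClInstance d L →
        Literature.Computability.Complexity.boolPair (Computability.encodeNat (Literature.Computability.Cryptography.Hallgren2005.clGenOrder d L)) [] <+: y}) →
    Literature.Computability.Cryptography.IsQSolvable fun x : List Bool =>
      {y : List Bool | Literature.Computability.Cryptography.IsNegFundamentalDiscr (Computability.decodeNat x) → P (Computability.decodeNat x) →
        List.ofFn (fun i : Fin x.length => (Literature.NumberTheory.QuadraticFields.BinaryQuadraticForm.classNumber (-(Computability.decodeNat x : ℤ))).testBit i.val) <+: y}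

end Registered

/-! ## The composition (kernel-checked; no `sorry` below) -/

/-- **`BrightClassNumberQSolvable_of`**: at brightness level `C`, S1 supplies `(A, d₀)`; S3 at the promise
`P d :≡ √d ≤ C·h(−d)·log d` with S2 gives the family (memberships unfold definitionally). -/
theorem BrightClassNumberQSolvable_of (h1 : Registered.stub_pairsGenerate)
    (h2 : Registered.stub_subgroupOrderDelim) (h3 : Registered.stub_samplerMachine) :
    BrightClassNumberQSolvable := by
  intro C
  obtain ⟨A, d₀, hcount⟩ := h1 C
  exact h3 (fun d : ℕ => Real.sqrt (d : ℝ) ≤ (C : ℝ) *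
      (Literature.NumberTheory.QuadraticFields.BinaryQuadraticForm.classNumber (-(d : ℤ)) : ℝ) * Real.log (d : ℝ))
    A d₀ (fun d hd hf hP => hcount d hd hf hP) h2

/-- Wiring check: the registered stubs feed the composition as stated. -/
example : BrightClassNumberQSolvable :=
  BrightClassNumberQSolvable_of stub_pairsGenerate stub_subgroupOrderDelim stub_samplerMachine

/-- Tree anchor (PROVED, the bare-prefix twin of S2): recorded so the skeleton audit sees the kernel in reach. -/
example : Literature.Computability.Cryptography.Hallgren2005.subgroupOrder_qsolvable :=
  Literature.Computability.Cryptography.Hallgren2005.subgroupOrder_qsolvable_holds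

end Summit.QuantumAdvantage.QuantumAdvantage.Cruxes.BrightClassNumberQSolvable.Birth

end
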